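import Summits.Ventures.QEC.Census.BB.BBQuotientMaps
import Summits.Ventures.QEC.Census.BB.BBRows
import Summits.Ventures.QEC.Census.BB.BB72Rank
import Summits.Ventures.QEC.Census.CertUpperFast
import HarnessLib

/-!
# Fixed exponent lists along the divisibility lattice of the torus: `k` can only grow, `d` grows at most
# linearly in an odd index — FAMILY form of the quotient-map lemma, and the gross-code family `QC(x³+y+y², y³+x+x²)`

Family phrasing (qec-search-8 g4; tier KERNEL, all PROVED, axioms standard, `[folklore]`/own, no priority word) of
`Census/TwoBlockQuotientMaps.lean` + `Census/BB/BBQuotientMaps.lean`: fix two exponent lists `TA, TB : List (ℕ × ℕ)` and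
put them on ANY torus, `ofTerms ℓ m TA TB = QC(Σ_{(a,b)∈TA} xᵃyᵇ, Σ_{(a,b)∈TB} xᵃyᵇ)` on `ℤ_ℓ × ℤ_m` (exponents read mod `ℓ`,
`m`; colliding monomials cancel mod 2). Then for `ℓ' ∣ ℓ`, `m' ∣ m` the code on the small torus is LITERALLY the
push-forward of the code on the big one along `torusHom` (`pushforward_ofTerms`), so:

* **`k_ofTerms_mono`**: `k(ofTerms ℓ' m' TA TB) ≤ k(ofTerms ℓ m TA TB)` — along the divisibility lattice of `(ℓ, m)` the
  number of logical qubits of a fixed-exponent family is MONOTONE (no parity condition);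
* **`d_ofTerms_le`**: if the index `(ℓ/ℓ')·(m/m')` is ODD and the small code is non-trivial, `d(ofTerms ℓ m) ≤ (ℓ/ℓ')(m/m') ·
  d(ofTerms ℓ' m')`.

The gross-code family (`grossA = [(3,0),(0,1),(0,2)]`, `grossB = [(0,3),(1,0),(2,0)]`, i.e. `QC(x³+y+y², y³+x+x²)`;
`ofTerms 6 6 = BB.bb72`, `ofTerms 12 6 = BB.bb144` literally): **for every `ℓ, m` divisible by `6` the code
`QC(x³+y+y², y³+x+x²)` on `ℤ_ℓ × ℤ_m` has `k ≥ 12`** (`gross_family_k_ge_twelve`, from the cell's `bb72_k = 12`), and if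
`(ℓ/6)(m/6)` is odd, `d ≤ 6·(ℓ/6)(m/6) = ℓm/6` (`gross_family_d_le`, from BB72's weight-6 logical). HONEST FRAMING: structural
corollaries; the `k ≥ 12` floor is a theorem about an infinite family of census objects (grid A, F_semi) but certifies no
distance; `BB.bb360`/`BB.bb288` are NOT members of this fixed-exponent family (their exponents differ before reduction).
-/

namespace Summit.Ventures.QEC

open Matrix Literature.InformationTheory.QuantumCodes
open Summit.Ventures.QEC.Census Summit.Ventures.QEC.Census.BBRows

namespace BB

variable {ℓ m ℓ' m' : ℕ} [NeZero ℓ] [NeZero m] [NeZero ℓ'] [NeZero m']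

/-! ### Fixed exponent lists on a torus -/

/-- The monomials `xᵃyᵇ`, `(a, b) ∈ T`, read on the torus `ℤ_ℓ × ℤ_m` (exponents mod `ℓ`, `m`). (definition) -/
def monoList (ℓ m : ℕ) [NeZero ℓ] [NeZero m] (T : List (ℕ × ℕ)) : List (BB.Mono ℓ m) :=
  T.map fun t => (Fin.ofNat ℓ t.1, Fin.ofNat m t.2)

/-- The code `QC(Σ_{TA} xᵃyᵇ, Σ_{TB} xᵃyᵇ)` on `ℤ_ℓ × ℤ_m` with FIXED exponent lists (coefficients mod 2). (definition) -/
def ofTerms (ℓ m : ℕ) [NeZero ℓ] [NeZero m] (TA TB : List (ℕ × ℕ)) : BB.Code ℓ m :=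
  ⟨polyL (monoList ℓ m TA), polyL (monoList ℓ m TB)⟩

/-- `φ_* 0 = 0`. [folklore] -/
theorem push_zero (φ : BB.Mono ℓ m →+ BB.Mono ℓ' m') : AbelianTwoBlock.push φ (0 : BB.Poly ℓ m) = 0 := by
  funext g'; simp [AbelianTwoBlock.push]

/-- Push-forward of a monomial sum: `φ_* (Σ_{g ∈ L} x^{g}) = Σ_{g ∈ L} x^{φ g}`. [folklore] -/
theorem push_polyL (φ : BB.Mono ℓ m →+ BB.Mono ℓ' m') (L : List (BB.Mono ℓ m)) :
    AbelianTwoBlock.push φ (polyL L) = polyL (L.map φ) := by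
  induction L with
  | nil => simpa [polyL] using push_zero φ
  | cons g L ih =>
    simp only [polyL, List.map_cons, List.sum_cons] at ih ⊢
    rw [AbelianTwoBlock.push_add, ih]
    congr 1
    simp only [BB.monomial, Prod.mk.eta]
    exact AbelianTwoBlock.push_single φ g 1

/-- `torusHom` sends `(a mod ℓ, b mod m)` to `(a mod ℓ', b mod m')`. [folklore] -/
theorem torusHom_ofNat (hl : ℓ' ∣ ℓ) (hm : m' ∣ m) (a b : ℕ) :
    torusHom ℓ m ℓ' m' hl hm (Fin.ofNat ℓ a, Fin.ofNat m b) = (Fin.ofNat ℓ' a, Fin.ofNat m' b) := by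
  refine Prod.ext (Fin.ext ?_) (Fin.ext ?_)
  · show (finMod ℓ ℓ' hl (Fin.ofNat ℓ a)).val = (Fin.ofNat ℓ' a).val
    rw [finMod_val, Fin.val_ofNat, Fin.val_ofNat, Nat.mod_mod_of_dvd _ hl]
  · show (finMod m m' hm (Fin.ofNat m b)).val = (Fin.ofNat m' b).val
    rw [finMod_val, Fin.val_ofNat, Fin.val_ofNat, Nat.mod_mod_of_dvd _ hm]

/-- Reducing the monomial list of `T` from the big torus gives the monomial list of `T` on the small torus. [folklore] -/
theorem monoList_map (hl : ℓ' ∣ ℓ) (hm : m' ∣ m) (T : List (ℕ × ℕ)) :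
    (monoList ℓ m T).map (torusHom ℓ m ℓ' m' hl hm) = monoList ℓ' m' T := by
  simp only [monoList, List.map_map]
  refine List.map_congr_left fun t _ => ?_
  exact torusHom_ofNat hl hm t.1 t.2

/-- **The small-torus code IS the push-forward of the big-torus code** (fixed exponent lists):
`pushforward (torusHom ℓ m ℓ' m') (ofTerms ℓ m TA TB) = ofTerms ℓ' m' TA TB`. [folklore] -/
theorem pushforward_ofTerms (hl : ℓ' ∣ ℓ) (hm : m' ∣ m) (TA TB : List (ℕ × ℕ)) :
    pushforward (torusHom ℓ m ℓ' m' hl hm) (ofTerms ℓ m TA TB) = ofTerms ℓ' m' TA TB := by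
  simp only [pushforward, ofTerms, push_polyL, monoList_map]

/-- **`k` is monotone along the divisibility lattice** for fixed exponent lists: `ℓ' ∣ ℓ`, `m' ∣ m` ⇒
`k(ofTerms ℓ' m' TA TB) ≤ k(ofTerms ℓ m TA TB)`. [folklore] -/
theorem k_ofTerms_mono (hl : ℓ' ∣ ℓ) (hm : m' ∣ m) (TA TB : List (ℕ × ℕ)) :
    (ofTerms ℓ' m' TA TB).k ≤ (ofTerms ℓ m TA TB).k := by
  rw [← pushforward_ofTerms hl hm]
  exact k_pushforward_le _ (torusHom_surjective ℓ m ℓ' m' hl hm) _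

/-- **`d` grows at most linearly in an ODD index** for fixed exponent lists: `ℓ' ∣ ℓ`, `m' ∣ m`, `(ℓ/ℓ')(m/m')` odd and
the small code non-trivial ⇒ `d(ofTerms ℓ m) ≤ (ℓ/ℓ')(m/m') · d(ofTerms ℓ' m')`. [folklore] -/
theorem d_ofTerms_le (hl : ℓ' ∣ ℓ) (hm : m' ∣ m) (TA TB : List (ℕ × ℕ)) (hodd : Odd (ℓ / ℓ' * (m / m')))
    (hk : 0 < (ofTerms ℓ' m' TA TB).k) :
    (ofTerms ℓ m TA TB).d ≤ ℓ / ℓ' * (m / m') * (ofTerms ℓ' m' TA TB).d := by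
  have h := d_le_mul_d_pushforward (torusHom ℓ m ℓ' m' hl hm) (torusHom_surjective ℓ m ℓ' m' hl hm)
    (by rwa [fibreCard_torusHom]) (ofTerms ℓ m TA TB) (by rwa [pushforward_ofTerms])
  rwa [fibreCard_torusHom, pushforward_ofTerms] at h

/-! ### The gross-code family `QC(x³+y+y², y³+x+x²)` on `ℤ_ℓ × ℤ_m`, `6 ∣ ℓ`, `6 ∣ m` -/

/-- Exponents of `A = x³ + y + y²`. -/
def grossA : List (ℕ × ℕ) := [(3, 0), (0, 1), (0, 2)]

/-- Exponents of `B = y³ + x + x²`. -/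
def grossB : List (ℕ × ℕ) := [(0, 3), (1, 0), (2, 0)]

/-- On the `6 × 6` torus the family member is `BB.bb72` literally. [folklore] -/
theorem ofTerms_six_six : ofTerms 6 6 grossA grossB = BB.bb72 := by
  simp only [ofTerms, BB.bb72, BB.Code.mk.injEq]
  constructor <;> decide +kernel

/-- On the `12 × 6` torus the family member is `BB.bb144` literally. [folklore] -/
theorem ofTerms_twelve_six : ofTerms 12 6 grossA grossB = BB.bb144 := by
  simp only [ofTerms, BB.bb144, BB.Code.mk.injEq]
  constructor <;> decide +kernel

/-- **Every member of the gross-code family on a torus with `6 ∣ ℓ`, `6 ∣ m` has at least 12 logical qubits**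
(`k`-monotonicity from `BB.bb72`, whose `k = 12` is the cell's rank certificate `bb72_k`). [folklore] -/
theorem gross_family_k_ge_twelve (hl : 6 ∣ ℓ) (hm : 6 ∣ m) : 12 ≤ (ofTerms ℓ m grossA grossB).k := by
  have h := k_ofTerms_mono hl hm grossA grossB
  rwa [ofTerms_six_six, bb72_k] at h

/-- BB72 has a weight-6 `Z`-logical (qubits 0, 1, 4, 5, 18, 20), re-checked on the kernel-computed words: `d(BB72) ≤ 6`
without importing the distance certificate. [folklore] -/
theorem bb72_d_le_six : BB.bb72.d ≤ 6 := by
  have hc : rowMatrix 72 (rowsX la72 lb72) * (rowMatrix 72 (rowsZ la72 lb72))ᵀ = 0 := by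
    rw [rowsX_bb72, rowsZ_bb72]; exact BB.bb72.HXFlat_mul_HZFlat_transpose
  have hchk : upperFastOK 8 72 (rowsX la72 lb72) (rowsZ la72 lb72) 6 1310771 2425751419687215824897 = true := by
    decide +kernel
  obtain ⟨hv, hv', hwt⟩ := upper_sound_fast hchk
  obtain ⟨v, h1, h2, h3⟩ := BB.bb72.zWitness_of_flat (D := CSSCode.ofMatrices _ _ hc) rowsX_bb72 rowsZ_bb72
    ⟨ofBits 72 1310771, hv, hv', hwt⟩
  rw [BB.Code.d_eq_dZ]
  exact (BB.bb72.css.dZ_le_hammingNorm h1 h2).trans_eq h3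

/-- **Odd multiples: `d ≤ ℓm/6`** — for `6 ∣ ℓ`, `6 ∣ m` with `(ℓ/6)(m/6)` odd, the family member on `ℤ_ℓ × ℤ_m` has
`d ≤ (ℓ/6)(m/6)·6` (the odd-index cover bound from BB72's weight-6 logical; e.g. `(18,6)`: `d ≤ 18`, `(18,18)`: `d ≤ 54`,
`(30,6)`: `d ≤ 30`). A structural ceiling, usually far from tight. [folklore] -/
theorem gross_family_d_le (hl : 6 ∣ ℓ) (hm : 6 ∣ m) (hodd : Odd (ℓ / 6 * (m / 6))) :
    (ofTerms ℓ m grossA grossB).d ≤ ℓ / 6 * (m / 6) * 6 := by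
  have hk : 0 < (ofTerms 6 6 grossA grossB).k := by rw [ofTerms_six_six, bb72_k]; decide
  have h := d_ofTerms_le hl hm grossA grossB hodd hk
  rw [ofTerms_six_six] at h
  exact h.trans (Nat.mul_le_mul_left _ bb72_d_le_six)

end BB

end Summit.Ventures.QEC
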